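import Literature.Computability.Cryptography.Harvey2021Bridge
import Literature.Computability.Complexity.StackMachinesTM2
import Literature.Computability.Complexity.StackZnVectors
import HarnessLib

/-!
# Harvey 2021: packaging a stack program for factoring as the machine of Theorem 1.1

Continuing `Harvey2021Bridge.lean` (`harvey_factoring_one_fifth_of_time_bound_poly`: a `TM2`
machine computing `Nat.primeFactorsList`, binary in, `encodeListNat` out, in time
`C · 2^{n/5} · (n+1)^c` witnesses **pqc.S09**, `harvey_factoring_one_fifth`).  The machines of
the tree that implement Harvey's algorithm are *structured stack programs* (`Com`,
`StackPrograms.lean`) over registers holding bit strings, compiled to Mathlib's `FinTM2` by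
`Com.outputsWithin_of_runs_equiv` (`StackMachinesTM2.lean`); their natural output format for a
list of numbers is the register code `encVec` (`StackZnVectors.lean`: every bit doubled, items
closed by `01`), over the alphabet `Bool`, whereas the statement asks for `encodeListNat` over
`Option Bool`.  This file closes that last, purely clerical gap once and for all:

* `vecFST`, `vecFST_eval_encVec` — a four-state finite-state transducer rewriting `encVec l` to
  `encodeListNat l`; `exists_transcoder` — its three-stack machine
  (`Transducers.lean`: `exists_transcoder`), linear time;
* `exists_machine_of_com` — a stack program `c` that runs from "input word `z` in register
  `inp`" to "`encVec l` in register `out`, all other registers empty" within budget `B` yields,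
  composed with the transcoder (`TM2ComputableAux.comp`, `TimeBoundsProofs.lean`), a machine
  `Bool → Option Bool` printing `encodeListNat l` within `B + 2 |encVec l| + 4` steps;
* `length_primeFactorsList_le_size`, `length_encVec_primeFactorsList_le` — the output has
  `O(n²)` bits (`n = |encodeNat N| = Nat.size N`);
* **`harvey_factoring_one_fifth_of_runs`** — if some stack program computes
  `encVec (Nat.primeFactorsList N)` from `encodeNat N` within
  `C · 2^{⌊n/5⌋} · (n+1)^k` steps for all `N`, then `harvey_factoring_one_fifth` holds.

* `base_init`, **`harvey_factoring_one_fifth_of_base_runs`** — the same for a program of the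
  numeric layer (`StackNumeric.lean`: registers `EReg ⊕ β`, files `Com.base T`), running from
  `Com.base (Regs.init inp (encodeNat N))` to
  `Com.base (Regs.init out (encVec (Nat.primeFactorsList N)))`.

So the remaining obligation of the programme is exactly one `Com.Runs` statement.

## References

* D. Harvey, *An exponent one-fifth algorithm for deterministic integer factorisation*,
  Math. Comp. 90 (2021) 2937–2950, Thm 1.1 (arXiv:2010.05450, Thm 1); the cost model of §2.1
  (multitape Turing machine, [Pap94]) is replaced by Mathlib's `FinTM2`. [Harvey2021]
* S. Arora, B. Barak, *Computational Complexity: A Modern Approach*, CUP 2009, §1.2–1.3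
  (encodings; machines running machines as subroutines). [AroraBarak2009]
-/

namespace Literature.Computability.Cryptography

open Turing _root_.Computability Literature.Computability.Complexity

namespace Harvey2021

/-! ### The output transcoder `encVec ↦ encodeListNat` -/

/-- The finite-state transducer reading the register code two bits at a time: a pair `bb` is the
payload bit `b` (emitted as `some b`), the pair `01` closes an item (emitted as the separator
`none`); state `none` = at an even position, `some x` = first bit `x` of a pair read.
[cite: AroraBarak2009, §1.2 (encodings of tuples)] -/
def vecFST : FST (Option Bool) Bool (Option Bool) where
  init := none
  step s b := match s with
    | none => (some b, [])
    | some x => (none, if x = b then [some b] else if b = true then [none] else [])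
  front _ := []
  keep _ := true

/-- Reading a doubled string emits its bits. [folklore] -/
theorem vecFST_run_dbl (a w : List Bool) :
    vecFST.run none (SProg.dbl a ++ w) =
      ((vecFST.run none w).1, a.map some ++ (vecFST.run none w).2) := by
  induction a with
  | nil => simp
  | cons b a ih =>
    rw [SProg.dbl_cons, List.cons_append, List.cons_append, FST.run_cons]
    have h1 : vecFST.step none b = (some b, []) := rfl
    rw [h1, FST.run_cons]
    have h2 : vecFST.step (some b) b = (none, [some b]) := by simp [vecFST]
    rw [h2, ih]
    simp

/-- Reading the item terminator `01` emits the separator. [folklore] -/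
theorem vecFST_run_sep (w : List Bool) :
    vecFST.run none (false :: true :: w) = ((vecFST.run none w).1, none :: (vecFST.run none w).2) := by
  rw [FST.run_cons]
  have h1 : vecFST.step none false = (some false, []) := rfl
  rw [h1, FST.run_cons]
  have h2 : vecFST.step (some false) true = (none, [none]) := by simp [vecFST]
  rw [h2]
  simp

/-- The transducer rewrites `encVec l` to `encodeListNat l`. [folklore] -/
theorem vecFST_run_encVec (l : List ℕ) : vecFST.run none (encVec l) = (none, encodeListNat l) := by
  induction l with
  | nil => simp [encodeListNat]
  | cons a l ih =>
    rw [encVec_cons, vecFST_run_dbl, vecFST_run_sep, ih, encodeListNat_cons]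

/-- The transduction of `encVec l` is `encodeListNat l`. [folklore] -/
theorem vecFST_eval_encVec (l : List ℕ) : vecFST.eval (encVec l) = encodeListNat l := by
  have h := vecFST_run_encVec l
  have hi : vecFST.init = none := rfl
  simp only [FST.eval, hi, h]
  rfl

/-- `|encodeListNat l| ≤ |encVec l|` (one letter per payload bit and per item, against two bits).
[folklore] -/
theorem length_encodeListNat_le_encVec (l : List ℕ) :
    (encodeListNat l).length ≤ (encVec l).length := by
  induction l with
  | nil => simp [encodeListNat]
  | cons a l ih =>
    rw [encodeListNat_cons, encVec_cons]
    simp only [List.length_append, List.length_map, List.length_cons, SProg.length_dbl]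
    omega

/-- Every emitted word of the transducer has length `≤ 1`. [folklore] -/
theorem vecFST_maxEmit_le : vecFST.maxEmit ≤ 1 := by
  unfold FST.maxEmit
  refine Finset.sup_le fun p _ => ?_
  rcases p with ⟨_ | x, b⟩
  · simp [vecFST]
  · simp only [vecFST]
    split_ifs <;> simp

/-- **The transcoder machine**: some machine `Bool → Option Bool` (the three-stack machine of
the transducer, `TM2Lift.fstTM`) prints `encodeListNat l` from `encVec l` within
`2 |encVec l| + 3` steps. [cite: AroraBarak2009, §1.2] -/
theorem exists_transcoder : ∃ M : TM2ComputableAux Bool (Option Bool), ∀ l : List ℕ,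
    M.OutputsWithin (encVec l) (encodeListNat l) (2 * (encVec l).length + 3) := by
  obtain ⟨M, hM⟩ := vecFST.timeComputable_eval
  refine ⟨M, fun l => ?_⟩
  have h := hM (encVec l)
  simp only [id, vecFST_eval_encVec] at h
  refine h.mono ?_
  have := vecFST_maxEmit_le
  have : (vecFST.maxEmit + 1) * (encVec l).length ≤ 2 * (encVec l).length :=
    Nat.mul_le_mul_right _ (by omega)
  omega

/-! ### From a stack program to a machine `Bool → Option Bool` -/

/-- **Compiling and transcoding.** For a stack program `c` over finitely many registers, with
input register `inp` and output register `out`, there is ONE machine (the compiled program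
followed by the transcoder) such that every run of `c` from `Regs.init inp z` to
`Regs.init out (encVec l)` within budget `B` makes the machine print `encodeListNat l` on input
`z` within `B + 2 |encVec l| + 4` steps. [cite: AroraBarak2009, §1.3 (subroutines)] -/
theorem exists_machine_of_com {ι : Type} [DecidableEq ι] [Fintype ι] (c : Com ι) (inp out : ι) :
    ∃ M : TM2ComputableAux Bool (Option Bool), ∀ (z : List Bool) (l : List ℕ) (B : ℕ),
      Com.Runs c (Regs.init inp z) (Regs.init out (encVec l)) B →
        M.OutputsWithin z (encodeListNat l) (B + 2 * (encVec l).length + 4) := by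
  let e := Fintype.equivFin ι
  obtain ⟨M₂, hM₂⟩ := exists_transcoder
  refine ⟨((Com.compile (c.map e)).toAux (e inp) (e out)).comp M₂, fun z l B h => ?_⟩
  have h₁ := Com.outputsWithin_of_runs_equiv e (Or.inl h)
  exact (TM2ComputableAux.comp_outputsWithin _ _ h₁ (hM₂ l)).mono (by omega)

/-! ### The size of the output -/

/-- A list of numbers `≥ 2` of length `k` has product `≥ 2^k`. [folklore] -/
theorem two_pow_length_le_prod {l : List ℕ} (h : ∀ p ∈ l, 2 ≤ p) : 2 ^ l.length ≤ l.prod := by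
  induction l with
  | nil => simp
  | cons a l ih =>
    rw [List.length_cons, List.prod_cons, pow_succ, mul_comm]
    exact Nat.mul_le_mul (h a (by simp)) (ih fun p hp => h p (by simp [hp]))

/-- `N` has at most `Nat.size N` prime factors counted with multiplicity. [folklore] -/
theorem length_primeFactorsList_le_size (N : ℕ) : (Nat.primeFactorsList N).length ≤ N.size := by
  rcases eq_or_ne N 0 with rfl | hN
  · simp
  have h2 : 2 ^ (Nat.primeFactorsList N).length ≤ N := by
    have := two_pow_length_le_prod (l := Nat.primeFactorsList N)
      (fun p hp => (Nat.prime_of_mem_primeFactorsList hp).two_le)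
    rwa [Nat.prod_primeFactorsList hN] at this
  exact (Nat.lt_size.2 h2).le

/-- The register code of the factorisation of `N` has at most `2 (n+1)²` bits, `n = Nat.size N`.
[folklore] -/
theorem length_encVec_primeFactorsList_le (N : ℕ) :
    (encVec (Nat.primeFactorsList N)).length ≤ 2 * (N.size + 1) ^ 2 := by
  have h1 : ∀ a ∈ Nat.primeFactorsList N, (encodeNat a).length ≤ N.size := by
    intro a ha
    rw [TM2Pass.length_encodeNat_eq_size]
    exact Nat.size_le_size (Nat.le_of_mem_primeFactorsList ha)
  have h2 := length_encVec_le h1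
  have h3 := length_primeFactorsList_le_size N
  calc (encVec (Nat.primeFactorsList N)).length
      ≤ (Nat.primeFactorsList N).length * (2 * N.size + 2) := h2
    _ ≤ N.size * (2 * N.size + 2) := Nat.mul_le_mul_right _ h3
    _ ≤ 2 * (N.size + 1) ^ 2 := by nlinarith

/-! ### The main packaging theorem -/

/-- `2^{⌊n/5⌋} ≤ 2^{n/5}` (natural versus real exponent). [folklore] -/
theorem two_pow_div_five_le (n : ℕ) : ((2 : ℕ) ^ (n / 5) : ℝ) ≤ (2 : ℝ) ^ ((n : ℝ) / 5) := by
  have h1 : ((2 : ℕ) ^ (n / 5) : ℝ) = (2 : ℝ) ^ (((n / 5 : ℕ) : ℝ)) := by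
    rw [Real.rpow_natCast]; push_cast; rfl
  rw [h1]
  exact Real.rpow_le_rpow_of_exponent_le one_le_two (Nat.cast_div_le)

/-- **Packaging.** If a structured stack program computes, for every `N`, the register code
`encVec (Nat.primeFactorsList N)` in its output register from the binary numeral `encodeNat N`
in its input register (all other registers empty before and after) within
`C · 2^{⌊n/5⌋} · (n+1)^k` steps, `n = Nat.size N = |encodeNat N|`, then Harvey's Theorem 1.1 in
the form **pqc.S09** holds: compile (`Com.outputsWithin_of_runs_equiv`), transcode
(`exists_machine_of_com`), bound the output size (`length_encVec_primeFactorsList_le`) and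
apply the `o(1)` bridge `harvey_factoring_one_fifth_of_time_bound_poly` with exponent `k + 2`.
[cite: Harvey2021, Thm 1.1 (arXiv Thm 1)] -/
theorem harvey_factoring_one_fifth_of_runs {ι : Type} [DecidableEq ι] [Fintype ι]
    (c : Com ι) (inp out : ι) (C k : ℕ)
    (h : ∀ N : ℕ, Com.Runs c (Regs.init inp (encodeNat N))
      (Regs.init out (encVec (Nat.primeFactorsList N))) (C * 2 ^ (N.size / 5) * (N.size + 1) ^ k)) :
    harvey_factoring_one_fifth := by
  obtain ⟨M, hM⟩ := exists_machine_of_com c inp out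
  -- the time function, indexed by the input length
  let t : ℕ → ℕ := fun n => (C + 8) * 2 ^ (n / 5) * (n + 1) ^ (k + 2)
  have hbound : ∀ N : ℕ, C * 2 ^ (N.size / 5) * (N.size + 1) ^ k +
      2 * (encVec (Nat.primeFactorsList N)).length + 4 ≤ t (encodeNat N).length := by
    intro N
    rw [TM2Pass.length_encodeNat_eq_size]
    have hL := length_encVec_primeFactorsList_le N
    set n := N.size
    have h1 : 1 ≤ 2 ^ (n / 5) := Nat.one_le_two_pow
    have h2 : (n + 1) ^ k * (n + 1) ^ 2 = (n + 1) ^ (k + 2) := by rw [← pow_add]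
    have h3 : 1 ≤ (n + 1) ^ k := Nat.one_le_pow _ _ (Nat.succ_pos n)
    have h4 : C * 2 ^ (n / 5) * (n + 1) ^ k ≤ C * 2 ^ (n / 5) * (n + 1) ^ (k + 2) := by
      rw [← h2]
      exact Nat.mul_le_mul_left _ (Nat.le_mul_of_pos_right _ (by positivity))
    have hX : 1 ≤ (n + 1) ^ 2 := Nat.one_le_pow _ _ (Nat.succ_pos n)
    have h5 : 2 * (encVec (Nat.primeFactorsList N)).length + 4 ≤ 8 * (n + 1) ^ 2 := by
      generalize (n + 1) ^ 2 = X at hL hX ⊢; omega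
    have h6 : 8 * (n + 1) ^ 2 ≤ 8 * 2 ^ (n / 5) * (n + 1) ^ (k + 2) := by
      rw [← h2]
      have : (n + 1) ^ 2 ≤ 2 ^ (n / 5) * ((n + 1) ^ k * (n + 1) ^ 2) := by
        calc (n + 1) ^ 2 = 1 * (1 * (n + 1) ^ 2) := by ring
          _ ≤ 2 ^ (n / 5) * ((n + 1) ^ k * (n + 1) ^ 2) :=
            Nat.mul_le_mul h1 (Nat.mul_le_mul_right _ h3)
      calc 8 * (n + 1) ^ 2 ≤ 8 * (2 ^ (n / 5) * ((n + 1) ^ k * (n + 1) ^ 2)) :=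
            Nat.mul_le_mul_left _ this
        _ = 8 * 2 ^ (n / 5) * ((n + 1) ^ k * (n + 1) ^ 2) := by ring
    calc C * 2 ^ (n / 5) * (n + 1) ^ k + 2 * (encVec (Nat.primeFactorsList N)).length + 4
        ≤ C * 2 ^ (n / 5) * (n + 1) ^ (k + 2) + 8 * 2 ^ (n / 5) * (n + 1) ^ (k + 2) := by omega
      _ = (C + 8) * 2 ^ (n / 5) * (n + 1) ^ (k + 2) := by ring
  have hcomp : ComputesInTime encodeNat encodeListNat Nat.primeFactorsList
      (fun N => t (encodeNat N).length) M :=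
    fun N => (hM _ _ _ (h N)).mono (hbound N)
  let MT : TM2ComputableInTime encodeNat encodeListNat Nat.primeFactorsList :=
    ⟨M, t, fun N => Classical.choice (hcomp N)⟩
  refine harvey_factoring_one_fifth_of_time_bound_poly MT (C + 8) (k + 2) fun n => ?_
  change ((t n : ℕ) : ℝ) ≤ _
  have h2 := two_pow_div_five_le n
  have h3 : (0 : ℝ) ≤ ((n : ℝ) + 1) ^ (k + 2) := by positivity
  simp only [t]
  push_cast
  have : ((C : ℝ) + 8) * (2 : ℝ) ^ (n / 5) * ((n : ℝ) + 1) ^ (k + 2)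
      ≤ ((C : ℝ) + 8) * (2 : ℝ) ^ ((n : ℝ) / 5) * ((n : ℝ) + 1) ^ (k + 2) := by
    apply mul_le_mul_of_nonneg_right _ h3
    apply mul_le_mul_of_nonneg_left _ (by positivity)
    exact_mod_cast h2
  linarith

/-! ### The same for programs of the numeric layer -/

/-- The clean numeric-layer file (`Com.base`, `StackNumeric.lean`) over an initial outer bank is
the initial file of the whole register type. [folklore] -/
theorem base_init {β : Type} [DecidableEq β] (r : β) (z : List Bool) :
    Com.base (Regs.init r z) = Regs.init (Sum.inr r : EReg ⊕ β) z := by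
  funext x
  rcases x with ((a | m) | w) | b
  · cases a <;> simp [Regs.init]
  · cases m <;> simp [Regs.init]
  · cases w <;> simp [Regs.init]
  · simp [Regs.init]

/-- **Packaging, numeric-layer form.** The same as `harvey_factoring_one_fifth_of_runs` for a
program over `EReg ⊕ β` (the calculator banks of `StackNumeric.lean` below the machine's own
registers `β`) running between clean files `Com.base (Regs.init …)`: input numeral in `inp`,
output code `encVec (Nat.primeFactorsList N)` in `out`. [cite: Harvey2021, Thm 1.1 (arXiv Thm 1)] -/
theorem harvey_factoring_one_fifth_of_base_runs {β : Type} [DecidableEq β] [Fintype β]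
    (c : Com (EReg ⊕ β)) (inp out : β) (C k : ℕ)
    (h : ∀ N : ℕ, Com.Runs c (Com.base (Regs.init inp (encodeNat N)))
      (Com.base (Regs.init out (encVec (Nat.primeFactorsList N))))
      (C * 2 ^ (N.size / 5) * (N.size + 1) ^ k)) :
    harvey_factoring_one_fifth := by
  refine harvey_factoring_one_fifth_of_runs c (Sum.inr inp) (Sum.inr out) C k fun N => ?_
  rw [← base_init, ← base_init]
  exact h N

end Harvey2021

end Literature.Computability.Cryptography
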